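import Literature.NumberTheory.Weil1965.AdelicSiegelCoeffHeightBound
import Literature.NumberTheory.Weil1965.SplitPlaceFibreMeasureInvariance
import HarnessLib

/-!
# The Eisenstein fibre measure `μ_b` at an auxiliary split place: Weil's Lemme 22 hypotheses and `μ_b(A × B) = c_B · μ_{b,v}(A)`

Topic `NumberTheory/Weil1965`; namespace `Literature.NumberTheory.Weil1965`.  KERNEL mathematics only (theorems; no definition,
no named fact, no `axiom`, no `sorry`).

Weil's fibre measures `μ_b = E_X|_{h⁻¹(b)}` of the Siegel–Eisenstein measure (★ `adelicSiegelFibreMeasure`, [Weil1965, Chap. IV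
n° 41 (35)]) are INVARIANT under every Haar-preserving homeomorphism `T` of `X = 𝔸_F^ι` with `h ∘ T = h` stabilising `𝒮(X)`
(★ `map_adelicSiegelFibreMeasure_eq`, [Weil1965, n° 46]) and CARRIED BY the fibre (★ `fibreMeasure_compl`).  Transported along a
SPLIT-PLACE CHART (letter (BRIDGE-v) of the SW2 I-CLOSE sheet: a homeomorphism `e : X ≃ (K^κ × K^κ) × Y` at a finite place `v` of `F`
split in `E`, under which the `v`-adic isometries act by `(x, y) ↦ (g x, g⁻ᵀ y)`, `g ∈ GL_κ(K)`, and the fibre `h = b` lands in the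
max-rank split locus `S_{b'} × Y`, `x ⬝ᵥ y = b'`), they satisfy the three hypotheses of the tree's Lemme 22
★ `SplitPlace.exists_measure_prod_splitLocus_eq_mul_fibreMeasure` — finite rectangle masses, `GL_κ(K)`-invariant, carried by
`S_{b'} × B` — hence

  `(e_* μ_b)(A × B) = c_B · μ_{b',v}(A)`   for every Borel `A` and every relatively compact Borel `B ⊆ Y`

(`map_adelicSiegelFibreMeasure_prod_eq_mul_fibreMeasure`; `∫⁻` form `lintegral_map_adelicSiegelFibreMeasure_eq_mul_fibreMeasure`) —
the letter (E-FAC) of the sheet («the Eisenstein-side fibre measure IS, at the split place, a multiple of the local fibre measure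
`|θ_b|_v`», [Weil1965, Chap. IV n° 44 Thm 2; Chap. V n° 49 Lemme 22]).  For the quadratic map `h = q_S` in `m > 4` variables over a
totally real `F` the condition-(B) input `hB` of `E_X` is DISCHARGED by ★ `summable_norm_adelicSiegelCoeff_sdForm`
(pass it as `hB`).

Cell `hodgecm-mathlib`, FLOOR 0, crux H413 (stmt-HodgeConjecture-24833), E-2 ∕ SW2 I-CLOSE sheet `SW2-ICLOSE-ASSEMBLY.v0` c78afe1b §1 (E-FAC)
(closer modulo (BRIDGE-v)).  HC_CM is proved only modulo the 7 printed citations until rung 0 closes; this file is unconditional.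

## References
* [Weil1965] A. Weil, *Sur la formule de Siegel dans la théorie des groupes classiques*, Acta Math. 113 (1965): Chap. IV n° 41
  (35) p. 59, n° 44 Thm 2 p. 63, n° 46 p. 66; Chap. V n° 49 Lemme 22 p. 70.
-/

set_option autoImplicit false

noncomputable section

open MeasureTheory Filter Topology Set NumberField IsDedekindDomain
open scoped NNReal ENNReal Matrix Classical
open Literature.NumberTheory.Automorphic
open Literature.NumberTheory.Weil1964
open Literature.NumberTheory.GaloisRepresentations.IsNonarchimedeanLocalField

namespace Literature.NumberTheory.Weil1965

section Helpers
variable {K : Type*} [Field K] [ValuativeRel K] [TopologicalSpace K] [IsNonarchimedeanLocalField K]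

/-- instance helper: `K` is second countable. [folklore] -/
private theorem secondCountable_K : SecondCountableTopology K := secondCountableTopology_localField K

/-- instance helper: `K` is Hausdorff. [folklore] -/
private theorem t2_K : T2Space K :=
  (Literature.NumberTheory.GaloisRepresentations.IsNonarchimedeanLocalField.isLocalField K).toT2Space

end Helpers

variable (F : Type) [Field F] [NumberField F] (ι : Type) [Fintype ι]
  [MeasurableSpace (adeleQuotient F)] [BorelSpace (adeleQuotient F)]
  [MeasurableSpace (AdeleRing (𝓞 F) F)] [BorelSpace (AdeleRing (𝓞 F) F)]
  (μ : Measure (ι → AdeleRing (𝓞 F) F)) [μ.IsAddHaarMeasure]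
  (h : (ι → AdeleRing (𝓞 F) F) → AdeleRing (𝓞 F) F) (hh : Continuous h)
  (hB : ∀ Φ ∈ piSchwartzBruhat F ι, Summable fun ξ : F => ‖adelicSiegelCoeff F ι μ h Φ ξ‖)
  {K : Type*} [Field K] [ValuativeRel K] [TopologicalSpace K] [IsNonarchimedeanLocalField K]
  [MeasurableSpace K] [BorelSpace K] [MeasurableSingletonClass K] (μK : Measure K) [μK.IsAddHaarMeasure]
  {κ : Type*} [Fintype κ] [Nonempty κ] [DecidableEq κ] (hκ : 2 ≤ Fintype.card κ)
  {Y : Type*} [TopologicalSpace Y] [T2Space Y] [MeasurableSpace Y] [BorelSpace Y] [SecondCountableTopology Y]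
  (e : (ι → AdeleRing (𝓞 F) F) ≃ₜ ((κ → K) × (κ → K)) × Y)
  (b : F) (b' : K)
  (hfib : ∀ x, h x = algebraMap F (AdeleRing (𝓞 F) F) b →
    (e x).1.1 ⬝ᵥ (e x).1.2 = b' ∧ (e x).1.1 ≠ 0 ∧ (e x).1.2 ≠ 0)
  (T : GL κ K → ((ι → AdeleRing (𝓞 F) F) ≃ₜ (ι → AdeleRing (𝓞 F) F)))
  (hTμ : ∀ g, MeasurePreserving (T g) μ μ) (hTh : ∀ g x, h (T g x) = h x)
  (hTS : ∀ g, ∀ Φ ∈ piSchwartzBruhat F ι, Φ ∘ T g ∈ piSchwartzBruhat F ι)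
  (hTe : ∀ g x, e (T g x) =
    ((((g : Matrix κ κ K) *ᵥ (e x).1.1, ((g⁻¹ : GL κ K) : Matrix κ κ K)ᵀ *ᵥ (e x).1.2) : (κ → K) × (κ → K)), (e x).2))


omit [MeasurableSingletonClass K] [Nonempty κ] in
include hfib hTμ hTh hTS hTe in
/-- the three hypotheses of the tree's Lemme 22 for `ν = e_* μ_b` and a relatively compact Borel `B ⊆ Y`: finite rectangle masses,
`GL_κ(K)`-invariance (from ★ `map_adelicSiegelFibreMeasure_eq` along `T g`), carried by `S_{b'} × B` (from ★ `fibreMeasure_compl`).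
[cite: Weil1965, Chap. IV n° 46, p. 66; n° 41 (35), p. 59] -/
theorem map_adelicSiegelFibreMeasure_lemme22_hypotheses {B : Set Y} (hBm : MeasurableSet B) (hBc : IsCompact (closure B)) :
    (∀ C : Set ((κ → K) × (κ → K)), IsCompact C → ((adelicSiegelFibreMeasure F ι μ h hh hB b).map e) (C ×ˢ B) < ⊤) ∧
    (∀ (g : GL κ K) (A : Set ((κ → K) × (κ → K))), MeasurableSet A →
      ((adelicSiegelFibreMeasure F ι μ h hh hB b).map e)
        (((fun z => (((g : Matrix κ κ K) *ᵥ z.1, ((g⁻¹ : GL κ K) : Matrix κ κ K)ᵀ *ᵥ z.2) : (κ → K) × (κ → K))) ⁻¹' A) ×ˢ B) =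
      ((adelicSiegelFibreMeasure F ι μ h hh hB b).map e) (A ×ˢ B)) ∧
    ((adelicSiegelFibreMeasure F ι μ h hh hB b).map e)
        ({z : (κ → K) × (κ → K) | z.1 ⬝ᵥ z.2 = b' ∧ z.1 ≠ 0 ∧ z.2 ≠ 0}ᶜ ×ˢ B) = 0 := by
  haveI : SecondCountableTopology K := secondCountable_K
  haveI : T2Space K := t2_K
  haveI := secondCountableTopology_adeleRing (K := F)
  haveI : BorelSpace (ι → AdeleRing (𝓞 F) F) := Pi.borelSpace
  haveI : BorelSpace (κ → K) := Pi.borelSpace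
  haveI : BorelSpace ((κ → K) × (κ → K)) := Prod.borelSpace
  haveI : BorelSpace (((κ → K) × (κ → K)) × Y) := Prod.borelSpace
  set ν₀ := adelicSiegelMeasure F ι μ h hh hB with hν₀
  set μb := adelicSiegelFibreMeasure F ι μ h hh hB b with hμb
  haveI : ν₀.Regular := regular_schwartzBruhatMeasure F ι _ _
  have hem : Measurable e := e.continuous.measurable
  have hmap : ∀ s : Set (((κ → K) × (κ → K)) × Y), MeasurableSet s → (μb.map e) s = μb (e ⁻¹' s) := fun s hs =>
    Measure.map_apply hem hs
  have hle : μb ≤ ν₀ := fibreMeasure_le F ι _ _ h b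
  refine ⟨?_, ?_, ?_⟩
  · -- finite rectangle masses: `e⁻¹(C × closure B)` is compact
    intro C hC
    calc (μb.map e) (C ×ˢ B) ≤ (μb.map e) (C ×ˢ closure B) := measure_mono (prod_mono subset_rfl subset_closure)
      _ = μb (e ⁻¹' (C ×ˢ closure B)) := hmap _ (hC.measurableSet.prod hBc.measurableSet)
      _ ≤ ν₀ (e ⁻¹' (C ×ˢ closure B)) := hle _
      _ < ⊤ := (e.isCompact_preimage.2 (hC.prod hBc)).measure_lt_top
  · -- `GL_κ(K)`-invariance of rectangle masses, from the invariance of `μ_b` under `T g`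
    intro g A hA
    set G : (κ → K) × (κ → K) → (κ → K) × (κ → K) := fun z =>
      (((g : Matrix κ κ K) *ᵥ z.1, ((g⁻¹ : GL κ K) : Matrix κ κ K)ᵀ *ᵥ z.2) : (κ → K) × (κ → K)) with hG
    have hGm : Measurable G :=
      ((continuous_const.matrix_mulVec continuous_fst).prodMk (continuous_const.matrix_mulVec continuous_snd)).measurable
    have hpre : e ⁻¹' ((G ⁻¹' A) ×ˢ B) = T g ⁻¹' (e ⁻¹' (A ×ˢ B)) := by
      ext x
      simp only [mem_preimage, mem_prod, hTe g x, hG]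
    rw [hmap _ ((hGm hA).prod hBm), hmap _ (hA.prod hBm), hpre, ← Measure.map_apply (T g).continuous.measurable
      (hem (hA.prod hBm)), (map_adelicSiegelFibreMeasure_eq hh hB (T g) (hTμ g) (hTh g) (hTS g) b).2]
  · -- carried by the max-rank split locus `S_{b'} × B`
    have hsub : e ⁻¹' ({z : (κ → K) × (κ → K) | z.1 ⬝ᵥ z.2 = b' ∧ z.1 ≠ 0 ∧ z.2 ≠ 0}ᶜ ×ˢ B) ⊆
        (h ⁻¹' {algebraMap F (AdeleRing (𝓞 F) F) b})ᶜ := by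
      intro x hx hxb
      simp only [mem_preimage, mem_prod, mem_compl_iff, mem_setOf_eq] at hx
      exact hx.1 (hfib x hxb)
    have hSm : MeasurableSet ({z : (κ → K) × (κ → K) | z.1 ⬝ᵥ z.2 = b' ∧ z.1 ≠ 0 ∧ z.2 ≠ 0}ᶜ ×ˢ B) := by
      refine MeasurableSet.prod (MeasurableSet.compl ?_) hBm
      have h1 : MeasurableSet {z : (κ → K) × (κ → K) | z.1 ⬝ᵥ z.2 = b'} :=
        (isClosed_eq (continuous_fst.dotProduct continuous_snd) continuous_const).measurableSet
      have h2 : MeasurableSet {z : (κ → K) × (κ → K) | z.1 ≠ 0} :=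
        (isClosed_eq continuous_fst continuous_const).measurableSet.compl
      have h3 : MeasurableSet {z : (κ → K) × (κ → K) | z.2 ≠ 0} :=
        (isClosed_eq continuous_snd continuous_const).measurableSet.compl
      simpa only [setOf_and] using h1.inter (h2.inter h3)
    rw [hmap _ hSm]
    exact measure_mono_null hsub (fibreMeasure_compl F ι _ _ h hh b)

include hfib hTμ hTh hTS hTe in
/-- **(E-FAC) — THE EISENSTEIN FIBRE MEASURE AT A SPLIT PLACE IS A MULTIPLE OF `μ_{b',v}` ON RECTANGLES**: for every relatively
compact Borel `B ⊆ Y` there is `c_B ≥ 0` with `(e_* μ_b)(A × B) = c_B · μ_{b',v}(A)` for every Borel `A ⊆ K^κ × K^κ` (★ Lemme 22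
`SplitPlace.exists_measure_prod_splitLocus_eq_mul_fibreMeasure`). [cite: Weil1965, Chap. V n° 49 Lemma 22, p. 70; Chap. IV n° 44 Thm 2, p. 63] -/
theorem map_adelicSiegelFibreMeasure_prod_eq_mul_fibreMeasure {B : Set Y} (hBm : MeasurableSet B)
    (hBc : IsCompact (closure B)) :
    ∃ c : ℝ≥0, ∀ A : Set ((κ → K) × (κ → K)), MeasurableSet A →
      ((adelicSiegelFibreMeasure F ι μ h hh hB b).map e) (A ×ˢ B) = c * SplitPlace.fibreMeasure μK hκ b' A := by
  obtain ⟨h1, h2, h3⟩ := map_adelicSiegelFibreMeasure_lemme22_hypotheses F ι μ h hh hB e b b' hfib T hTμ hTh hTS hTe hBm hBc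
  exact SplitPlace.exists_measure_prod_splitLocus_eq_mul_fibreMeasure μK hκ b' _ h1 h2 h3

include hfib hTμ hTh hTS hTe in
/-- the `∫⁻` form of (E-FAC): `∫⁻ f(z) 𝟙_B(y) d(e_* μ_b) = c_B · ∫⁻ f dμ_{b',v}` for Borel `f ≥ 0`
(★ `SplitPlace.exists_lintegral_fst_mul_indicator_snd_eq_mul_fibreMeasure`). [cite: Weil1965, Chap. V n° 49 Lemma 22, p. 70] -/
theorem lintegral_map_adelicSiegelFibreMeasure_eq_mul_fibreMeasure {B : Set Y} (hBm : MeasurableSet B)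
    (hBc : IsCompact (closure B)) :
    ∃ c : ℝ≥0, ∀ f : (κ → K) × (κ → K) → ℝ≥0∞, Measurable f →
      ∫⁻ p, f p.1 * B.indicator 1 p.2 ∂((adelicSiegelFibreMeasure F ι μ h hh hB b).map e) =
        c * ∫⁻ z, f z ∂(SplitPlace.fibreMeasure μK hκ b') := by
  obtain ⟨h1, h2, h3⟩ := map_adelicSiegelFibreMeasure_lemme22_hypotheses F ι μ h hh hB e b b' hfib T hTμ hTh hTS hTe hBm hBc
  exact SplitPlace.exists_lintegral_fst_mul_indicator_snd_eq_mul_fibreMeasure μK hκ b' _ hBm h1 h2 h3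

end Literature.NumberTheory.Weil1965

end
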